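import Summits.NavierStokesRegularity.NavierStokesRegularity.Theorems.AdaptedFrequencyAdaptedKernelExistsPrekernelBridge

/-!
# Crux `AdaptedFrequencyConverges` (stmt-NavierStokesRegularity-10493), line
  `cloud-frame-effective-tsai`: the TERMINAL LAYER estimate for STUB `stub_blockSolver`

Helper file (lands `--supports stmt-NavierStokesRegularity-10493`).  The block solver is the
limit of solutions `g` of the backward drift–heat equation with a drift cut off near the
terminal time; each of them coincides with the free (caloric) solution `F` above its own top
time `t₁`.  This file controls `g − F` BELOW `t₁` uniformly in the cut-off: if the reversed
rescaled `v(σ) = g(t₁ − σ/ν)` is in the tree's local drift–heat class with drift bound `B/ν`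
(`IsDriftHeatSolutionOn`, `DriftHeatLocalClass`), `F` is a classical solution of the backward
HEAT equation `∂ₜF = −νΔF` on `[t, t₁]` with `‖∇F‖ ≤ L`, `g(t₁) = F(t₁)`, and `F`, `g` are
nonnegative and small at spatial infinity uniformly on the block, then

  `|g(s, x) − F(s, x)| ≤ B L (t₁ − s)`  on `[t, t₁] × E`   (`terminal_comparison`).

Proof: the tree's comparison principle `IsDriftHeatSolutionOn.paraboloid_comparison`
(Lieberman 1996, Ch. II, Cor. 2.5) on the cylinders `[0, ν(t₁ − t)] × B̄(0, ρ)` with the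
classical barrier `φ(σ) = F(t₁ − σ/ν) − (BL/ν)σ − ε`: since `∂_σφ = ΔF − BL/ν`, `Δφ = ΔF` and
`‖∇φ‖ = ‖∇F‖ ≤ L`, the barrier satisfies the DRIFT-ROBUST subsolution inequality
`∂_σφ ≤ Δφ − (B/ν)‖∇φ‖`; it lies below `v` at the bottom (`F(t₁) = g(t₁)`) and on the side
(`F ≤ ε` far away, `g ≥ 0`); `ρ → ∞`, `ε → 0` (`terminal_oneSided`).  The bound from above is
the same statement for `(−g, −F)` (the class is closed under `v ↦ −v`).
-/

noncomputable section

open MeasureTheory Set Filter Topology Metric Function Real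
open scoped Laplacian ContDiff
open Literature.Analysis.FluidPDE
open Summit.NavierStokesRegularity.NavierStokesRegularity.Theorems.AdaptedKernelExists.NashEntropyLastBlock

namespace Summit.NavierStokesRegularity.NavierStokesRegularity.Theorems.AdaptedFrequencyConverges.CloudFrameEffectiveTsai

section General

variable {E : Type*} [NormedAddCommGroup E] [InnerProductSpace ℝ E] [FiniteDimensional ℝ E]
  [MeasurableSpace E] [BorelSpace E]

/-- **One-sided terminal comparison.**  Let `v(σ) = G(t₁ − σ/ν)` be in the local drift–heat
class on `[0, ν(t₁ − t)] × E` with drift bound `B/ν` (`ν > 0`, `B ≥ 0`, `t < t₁`), and let `F`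
be a classical solution of `∂ₜF = −νΔF` on `[t, t₁]` (`C²` slices, jointly continuous, `∇F` and
`ΔF` continuous along time lines) with `‖∇F‖ ≤ L`.  If `F(t₁, ·) ≤ G(t₁, ·)` and, for every
`ε > 0`, `F ≤ G + ε` far away uniformly on the block, then
`F(s, x) − B L (t₁ − s) ≤ G(s, x)` on `[t, t₁] × E`. -/
theorem terminal_oneSided {ν t t₁ B L : ℝ} {G F : ℝ → E → ℝ} {a : ℝ → E → E}
    (hν : 0 < ν) (htt₁ : t < t₁) (hB : 0 ≤ B)
    (hv : IsDriftHeatSolutionOn a (fun σ => G (t₁ - σ / ν)) (B / ν) (Icc 0 (ν * (t₁ - t))) univ)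
    (hF2 : ∀ s ∈ Icc t t₁, ContDiff ℝ 2 (F s))
    (hFc : ContinuousOn (uncurry F) (Icc t t₁ ×ˢ univ))
    (hFt : ∀ x, ∀ s ∈ Icc t t₁, HasDerivAt (fun r => F r x) (-(ν * (Δ (F s)) x)) s)
    (hFD_c : ∀ x, ContinuousOn (fun s => fderiv ℝ (F s) x) (Icc t t₁))
    (hFΔ_c : ∀ x, ContinuousOn (fun s => (Δ (F s)) x) (Icc t t₁))
    (hFD : ∀ s ∈ Icc t t₁, ∀ x, ‖fderiv ℝ (F s) x‖ ≤ L)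
    (htop : ∀ x, F t₁ x ≤ G t₁ x)
    (hfar : ∀ ε : ℝ, 0 < ε → ∃ ρ₀ : ℝ, ∀ s ∈ Icc t t₁, ∀ y, ρ₀ ≤ ‖y‖ → F s y ≤ G s y + ε) :
    ∀ s ∈ Icc t t₁, ∀ x, F s x - B * L * (t₁ - s) ≤ G s x := by
  set M : ℝ := B * L with hM
  have hL : 0 ≤ L := (norm_nonneg _).trans (hFD t₁ (right_mem_Icc.2 htt₁.le) 0)
  have hM0 : 0 ≤ M := by rw [hM]; positivity
  have hmem : ∀ σ ∈ Icc 0 (ν * (t₁ - t)), t₁ - σ / ν ∈ Icc t t₁ := fun σ hσ => prekernel_mem_Icc hν hσ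
  -- the time change `r(σ) = t₁ − σ/ν`
  have hlin : ∀ σ, HasDerivAt (fun σ' : ℝ => t₁ - σ' / ν) (-(1 / ν)) σ := fun σ => by
    simpa using ((hasDerivAt_id σ).div_const ν).const_sub t₁
  have hrc : Continuous fun σ : ℝ => t₁ - σ / ν := by fun_prop
  intro s hs x
  have main : ∀ ε : ℝ, 0 < ε → F s x - M * (t₁ - s) - ε ≤ G s x := by
    intro ε hε
    obtain ⟨ρ₀, hρ₀⟩ := hfar ε hε
    obtain ⟨ρ, hρ⟩ : ∃ ρ : ℝ, ρ = max ρ₀ ‖x‖ + 1 := ⟨_, rfl⟩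
    have hρx : ‖x‖ ≤ ρ := by rw [hρ]; linarith [le_max_right ρ₀ ‖x‖]
    have hρρ₀ : ρ₀ ≤ ρ := by rw [hρ]; linarith [le_max_left ρ₀ ‖x‖]
    have hρ0 : 0 < ρ := by rw [hρ]; linarith [le_max_right ρ₀ ‖x‖, norm_nonneg x]
    -- the barrier `φ(σ, y) = F(t₁ − σ/ν, y) − (M/ν)σ − ε`
    set φ : ℝ → E → ℝ := fun σ y => F (t₁ - σ / ν) y - (M / ν * σ + ε) with hφ
    set φt : ℝ → E → ℝ := fun σ y => (Δ (F (t₁ - σ / ν))) y - M / ν with hφt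
    have hφD : ∀ σ y, fderiv ℝ (φ σ) y = fderiv ℝ (F (t₁ - σ / ν)) y := by
      intro σ y
      simp only [hφ]
      exact fderiv_sub_const _
    have hφΔ : ∀ σ ∈ Icc 0 (ν * (t₁ - t)), ∀ y, (Δ (φ σ)) y = (Δ (F (t₁ - σ / ν))) y := by
      intro σ hσ y
      have hc : ContDiffAt ℝ 2 (F (t₁ - σ / ν)) y := (hF2 _ (hmem σ hσ)).contDiffAt
      simp only [hφ]
      rw [show (fun y => F (t₁ - σ / ν) y - (M / ν * σ + ε)) =
        F (t₁ - σ / ν) - fun _ => (M / ν * σ + ε) by funext y; simp only [Pi.sub_apply]]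
      rw [hc.laplacian_sub contDiffAt_const, InnerProductSpace.laplacian_const]
      simp
    have key := hv.paraboloid_comparison (c := 0) (t_b := 0) (t_T := ν * (t₁ - t))
      (P := fun _ => ρ ^ 2) (φ := φ) (φt := φt) isOpen_univ Subset.rfl continuous_const
      (fun _ _ _ _ => mem_univ _) ?_ ?_ ?_ ?_ ?_ ?_ ?_ ?_ ?_
    · have hσs : ν * (t₁ - s) ∈ Icc 0 (ν * (t₁ - t)) :=
        ⟨mul_nonneg hν.le (by linarith [hs.2]), mul_le_mul_of_nonneg_left (by linarith [hs.1]) hν.le⟩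
      have h := key (ν * (t₁ - s)) hσs x (by
        rw [sub_zero]; exact pow_le_pow_left₀ (norm_nonneg _) hρx 2)
      have e1 : t₁ - ν * (t₁ - s) / ν = s := by field_simp; ring
      simp only [hφ, e1] at h
      have e2 : M / ν * (ν * (t₁ - s)) = M * (t₁ - s) := by field_simp
      rw [e2] at h
      linarith [h]
    · -- joint continuity of the barrier
      have h1 : ContinuousOn (fun p : ℝ × E => F (t₁ - p.1 / ν) p.2)
          (Icc 0 (ν * (t₁ - t)) ×ˢ univ) := by
        have hm : MapsTo (fun p : ℝ × E => (t₁ - p.1 / ν, p.2)) (Icc 0 (ν * (t₁ - t)) ×ˢ univ)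
            (Icc t t₁ ×ˢ univ) := fun p hp => ⟨hmem p.1 hp.1, mem_univ _⟩
        exact hFc.comp (by fun_prop) hm
      have h2 : Continuous fun p : ℝ × E => M / ν * p.1 + ε := by fun_prop
      refine (h1.sub h2.continuousOn).congr fun p _ => ?_
      simp only [hφ, uncurry, Pi.sub_apply]
    · intro σ hσ
      simp only [hφ]
      exact (hF2 _ (hmem σ hσ)).sub contDiff_const
    · intro y σ hσ
      have hd := (hFt y _ (hmem σ hσ)).comp σ (hlin σ)
      have hd' : HasDerivAt (fun σ' => F (t₁ - σ' / ν) y) ((Δ (F (t₁ - σ / ν))) y) σ := by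
        refine hd.congr_deriv ?_
        field_simp
      have h3 : HasDerivAt (fun σ' : ℝ => M / ν * σ' + ε) (M / ν) σ := by
        simpa using ((hasDerivAt_id σ).const_mul (M / ν)).add_const ε
      exact hd'.sub h3
    · intro y
      have h1 : ContinuousOn (fun σ => (Δ (F (t₁ - σ / ν))) y) (Icc 0 (ν * (t₁ - t))) :=
        (hFΔ_c y).comp hrc.continuousOn fun σ hσ => hmem σ hσ
      simp only [hφt]
      exact h1.sub continuousOn_const
    · intro y
      have h1 : ContinuousOn (fun σ => fderiv ℝ (F (t₁ - σ / ν)) y) (Icc 0 (ν * (t₁ - t))) :=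
        (hFD_c y).comp hrc.continuousOn fun σ hσ => hmem σ hσ
      exact h1.congr fun σ _ => hφD σ y
    · intro y
      have h1 : ContinuousOn (fun σ => (Δ (F (t₁ - σ / ν))) y) (Icc 0 (ν * (t₁ - t))) :=
        (hFΔ_c y).comp hrc.continuousOn fun σ hσ => hmem σ hσ
      exact h1.congr fun σ hσ => hφΔ σ hσ y
    · -- the drift-robust subsolution inequality
      intro σ hσ y _
      have hσ' : σ ∈ Icc 0 (ν * (t₁ - t)) := ⟨hσ.1.le, hσ.2⟩
      rw [hφΔ σ hσ' y, hφD σ y]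
      simp only [hφt]
      have h1 : B / ν * ‖fderiv ℝ (F (t₁ - σ / ν)) y‖ ≤ M / ν :=
        calc B / ν * ‖fderiv ℝ (F (t₁ - σ / ν)) y‖ ≤ B / ν * L :=
              mul_le_mul_of_nonneg_left (hFD _ (hmem σ hσ') y) (by positivity)
          _ = M / ν := by rw [hM]; ring
      linarith
    · -- bottom
      intro y _
      simp only [hφ, zero_div, sub_zero, mul_zero, zero_add]
      linarith [htop y]
    · -- side
      intro σ hσ y hy
      rw [sub_zero] at hy
      have hyρ : ‖y‖ = ρ := (pow_left_inj₀ (norm_nonneg _) hρ0.le two_ne_zero).1 hy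
      have h1 := hρ₀ _ (hmem σ hσ) y (by rw [hyρ]; exact hρρ₀)
      simp only [hφ]
      have h2 : 0 ≤ M / ν * σ := mul_nonneg (by positivity) hσ.1
      linarith
  refine le_of_forall_pos_le_add fun ε hε => ?_
  have h := main ε hε
  rw [hM] at h
  linarith

/-- **The terminal layer estimate.**  In the setting of `terminal_oneSided`, if moreover
`G(t₁) = F(t₁)`, `F ≥ 0`, `G ≥ 0` on the block and both `F` and `G` tend to `0` at spatial
infinity uniformly on the block, then `|G(s, x) − F(s, x)| ≤ B L (t₁ − s)` on `[t, t₁] × E`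
(`terminal_oneSided` for `(G, F)` and for `(−G, −F)`). -/
theorem terminal_comparison {ν t t₁ B L : ℝ} {G F : ℝ → E → ℝ} {a : ℝ → E → E}
    (hν : 0 < ν) (htt₁ : t < t₁) (hB : 0 ≤ B)
    (hv : IsDriftHeatSolutionOn a (fun σ => G (t₁ - σ / ν)) (B / ν) (Icc 0 (ν * (t₁ - t))) univ)
    (hF2 : ∀ s ∈ Icc t t₁, ContDiff ℝ 2 (F s))
    (hFc : ContinuousOn (uncurry F) (Icc t t₁ ×ˢ univ))
    (hFt : ∀ x, ∀ s ∈ Icc t t₁, HasDerivAt (fun r => F r x) (-(ν * (Δ (F s)) x)) s)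
    (hFD_c : ∀ x, ContinuousOn (fun s => fderiv ℝ (F s) x) (Icc t t₁))
    (hFΔ_c : ∀ x, ContinuousOn (fun s => (Δ (F s)) x) (Icc t t₁))
    (hFD : ∀ s ∈ Icc t t₁, ∀ x, ‖fderiv ℝ (F s) x‖ ≤ L)
    (htop : ∀ x, G t₁ x = F t₁ x)
    (hF0 : ∀ s ∈ Icc t t₁, ∀ x, 0 ≤ F s x) (hG0 : ∀ s ∈ Icc t t₁, ∀ x, 0 ≤ G s x)
    (hFfar : ∀ ε : ℝ, 0 < ε → ∃ ρ₀ : ℝ, ∀ s ∈ Icc t t₁, ∀ y, ρ₀ ≤ ‖y‖ → F s y ≤ ε)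
    (hGfar : ∀ ε : ℝ, 0 < ε → ∃ ρ₀ : ℝ, ∀ s ∈ Icc t t₁, ∀ y, ρ₀ ≤ ‖y‖ → G s y ≤ ε) :
    ∀ s ∈ Icc t t₁, ∀ x, |G s x - F s x| ≤ B * L * (t₁ - s) := by
  -- from below: `F − BL(t₁ − s) ≤ G`
  have hlow := terminal_oneSided hν htt₁ hB hv hF2 hFc hFt hFD_c hFΔ_c hFD
    (fun x => (htop x).ge) (fun ε hε => by
      obtain ⟨ρ₀, hρ₀⟩ := hFfar ε hε
      exact ⟨ρ₀, fun s hs y hy => (hρ₀ s hs y hy).trans (by linarith [hG0 s hs y])⟩)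
  -- from above: the same for `(−G, −F)`
  have hΔneg : ∀ s (y : E), (Δ (fun y => -F s y)) y = -(Δ (F s)) y := fun s y => by
    rw [show (fun y => -F s y) = -F s from rfl, InnerProductSpace.laplacian_neg]; rfl
  have hDneg : ∀ s (y : E), fderiv ℝ (fun y => -F s y) y = -fderiv ℝ (F s) y := fun s y =>
    fderiv_fun_neg
  have hup := terminal_oneSided (G := fun s y => -G s y) (F := fun s y => -F s y) hν htt₁ hB hv.neg
    (fun s hs => (hF2 s hs).neg) hFc.neg
    (fun x s hs => by
      have h := (hFt x s hs).neg
      rw [hΔneg s x]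
      exact h.congr_deriv (by ring))
    (fun x => by
      have h := (hFD_c x).neg
      exact h.congr fun s _ => hDneg s x)
    (fun x => by
      have h := (hFΔ_c x).neg
      exact h.congr fun s _ => hΔneg s x)
    (fun s hs x => by rw [hDneg s x, norm_neg]; exact hFD s hs x)
    (fun x => by rw [htop x])
    (fun ε hε => by
      obtain ⟨ρ₀, hρ₀⟩ := hGfar ε hε
      exact ⟨ρ₀, fun s hs y hy => by linarith [hρ₀ s hs y hy, hF0 s hs y]⟩)
  intro s hs x
  rw [abs_le]
  constructor
  · linarith [hlow s hs x]
  · have h := hup s hs x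
    linarith

end General

/-! ### Registered sub-goal (dimension three) -/

/-- **Registered sub-goal `stub_blockSolver_terminal`** (the `ℝ³` form of `terminal_comparison`,
sub-goal of STUB `stub_blockSolver`): the terminal layer estimate `|G − F| ≤ B L (t₁ − s)` below a
top time at which the drift–heat solution `G` coincides with the caloric solution `F`. -/
theorem stub_blockSolver_terminal :
    ∀ (ν t t₁ B L : ℝ) (G F : ℝ → (EuclideanSpace ℝ (Fin 3)) → ℝ) (a : ℝ → (EuclideanSpace ℝ (Fin 3)) → (EuclideanSpace ℝ (Fin 3))), 0 < ν → t < t₁ → 0 ≤ B → IsDriftHeatSolutionOn a (fun σ => G (t₁ - σ / ν)) (B / ν) (Icc 0 (ν * (t₁ - t))) univ → (∀ s ∈ Icc t t₁, ContDiff ℝ 2 (F s)) → ContinuousOn (uncurry F) (Icc t t₁ ×ˢ univ) → (∀ x, ∀ s ∈ Icc t t₁, HasDerivAt (fun r => F r x) (-(ν * Laplacian.laplacian (F s) x)) s) → (∀ x, ContinuousOn (fun s => fderiv ℝ (F s) x) (Icc t t₁)) → (∀ x, ContinuousOn (fun s => Laplacian.laplacian (F s) x) (Icc t t₁)) → (∀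 s ∈ Icc t t₁, ∀ x, ‖fderiv ℝ (F s) x‖ ≤ L) → (∀ x, G t₁ x = F t₁ x) → (∀ s ∈ Icc t t₁, ∀ x, 0 ≤ F s x) → (∀ s ∈ Icc t t₁, ∀ x, 0 ≤ G s x) → (∀ ε : ℝ, 0 < ε → ∃ ρ₀ : ℝ, ∀ s ∈ Icc t t₁, ∀ y, ρ₀ ≤ ‖y‖ → F s y ≤ ε) → (∀ ε : ℝ, 0 < ε → ∃ ρ₀ : ℝ, ∀ s ∈ Icc t t₁, ∀ y, ρ₀ ≤ ‖y‖ → G s y ≤ ε) → ∀ s ∈ Icc t t₁, ∀ x, |G s x - F s x| ≤ B * L * (t₁ - s) :=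
  fun _ _ _ _ _ _ _ _ hν htt₁ hB hv hF2 hFc hFt hFD_c hFΔ_c hFD htop hF0 hG0 hFfar hGfar =>
    terminal_comparison hν htt₁ hB hv hF2 hFc hFt hFD_c hFΔ_c hFD htop hF0 hG0 hFfar hGfar

end Summit.NavierStokesRegularity.NavierStokesRegularity.Theorems.AdaptedFrequencyConverges.CloudFrameEffectiveTsai

end
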